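import Literature.NumberTheory.DiophantineGeometry.AbcHeightBoundFreyHellegouarchProofs
import Literature.NumberTheory.DiophantineGeometry.MordellHeightBoundModularityProofs
import Literature.NumberTheory.DiophantineGeometry.OptimizedHeightBoundsModularity
import Literature.NumberTheory.EllipticCurves.HeightConductorBoundsAlphaMonotoneProofs
import Literature.NumberTheory.EllipticCurves.HeightConductorBoundsExplicitInputsProofs
import HarnessLib

/-!
# von Känel–Matschke, Prop. 10.7 (the optimized bounds) from Lemmas 10.3/10.5 and Prop. 10.8 (i) —
# the printed proof of §10.5.1, in kernel

Topic `Literature/NumberTheory/DiophantineGeometry` (family `abc`, LADDER-ABC A1: the *modular method*).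
Theorems only — NO new statement, NO new named fact (D-0026). R. von Känel, B. Matschke,
arXiv:1605.06079 = Mem. AMS **286** (2023) no. 1419 [`VonkanelMatschke2023`], §10.5.1, proof of
Prop. 10.7 (`prop:algobounds`): *"We observe that `α(m) ≤ α(n)` for all `m, n ∈ ℤ_{≥1}` with `m`
dividing `n`. Therefore we see that the statements follow by using in the above proofs of
Propositions 10.1, 10.2 and 10.6 the inequalities `log m_f ≤ log r_f ≤ α` of Proposition 10.8 (i)
instead of (eq:szpiro)."*

Over the tree, with `α(m) ≤ α(n)` PROVED (`vkmAlpha_le_of_dvd`, file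
`HeightConductorBoundsAlphaMonotoneProofs`):
* `two_mul_height_le_alpha`, `log_minimalDiscriminant_le_alpha` — Prop. 10.8 (i) read as
  `2h(E) ≤ κ + α(N_E)` and, with `log Δ_E ≤ 12 h(E) + 16` (Silverman, PROVED in the tree),
  `log Δ_E ≤ 6 α(N_E) + 6κ + 16` (the "(eq:szpiro) with `α`" of the printed sentence);
* `abc_log_max_le_alpha_of_lemma_10_5` — the first conjunct of `proposition_10_7`
  (`log max(|a|,|b|,|c|) ≤ (6/5) α(2^𝔢 N_S) + 28`) from Lemma 10.5 exactly as in the proof of Prop. 10.6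
  (`AbcHeightBoundFreyHellegouarchProofs`): `(|c|−1)⁵ ≤ 2²⁸ Δ_{E'}`, `N_{E'} = N_E ∣ 2^𝔢 N_S`
  (isogeny invariance of the conductor via the Ogg–Saito schema, or a hypothesis; `ord₂(N_E) = 𝔢 + 1`), so
  `5 log(|c|−1) ≤ 28 log 2 + 6 α(2^𝔢 N_S) + 6κ + 16` and `(33 log 2 + 115.1)/5 ≤ 28`;
* `mordell_height_le_omegaOpt_of_lemma_10_3` — the second conjunct (`max(h(x), (2/3)h(y)) ≤ Ω_opt`)
  from Lemma 10.3: `8h(E) ≤ 4κ + 4α(a_S)`, `2 log max(1, h(E)) ≤ 2 log(α(a_S) + κ) − 2 log 2`,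
  `36 − 2 log 2 ≤ 35`;
* `proposition_10_7_of_roots` — **Prop. 10.7 ⟸ {modularity, Ogg–Saito schema, Lemma 10.3,
  Lemma 10.5, Prop. 10.8 (i)}**; hence also Cor. 9.1-sim / Cor. 9.3-sim and Prop. 10.1 through
  `OptimizedSimplifiedHeightBoundsProofs`; `abc_log_max_le_alpha_of_lemma_10_5_of_conductorNorm_eq` and
  `proposition_10_7_of_conductorNorm_eq` take the conductor invariance as a hypothesis `hcond` instead.

No `abc` claim; typed ≠ proved: the roots remain named facts. All theorems; axioms standard.

## References

* R. von Känel, B. Matschke, arXiv:1605.06079 (2016) = Mem. AMS 286 (2023), Prop. 10.7 (§10.5.1) and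
  its proof; §10.3 (proof of Prop. 10.1), §10.4 (proof of Prop. 10.6). [VonkanelMatschke2023]
-/

noncomputable section

open Height WeierstrassCurve
open Literature.NumberTheory.EllipticCurves

namespace Literature.NumberTheory.EllipticCurves.ModularForms

open DiophantineGeometry

/-! ### `α ≥ 0`; Prop. 10.8 (i) as `2h(E) ≤ κ + α(N)` and `log Δ_E ≤ 6α(N) + 6κ + 16` -/

/-- `α(N) = min(β, β*) ≥ 0` (`m log m ≥ 0`, `g log g ≥ 0`, the `max_J`-terms are `≥ 0`).
[cite: VonkanelMatschke2023, §10.5.1 (def:bb*)] -/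
theorem zero_le_vkmAlpha (N : ℕ) : 0 ≤ vkmAlpha N := by
  unfold vkmAlpha vkmBeta vkmBetaStar
  have h1 := maxLogTauSum_nonneg (vkmIndexL N) (newformCount N)
  have h2 := maxLogTauSum_nonneg (vkmIndexLStar N) (genusX0 N)
  have h3 : ∀ m : ℕ, 0 ≤ 1 / 2 * (m : ℝ) * Real.log m := fun m ↦ by
    rcases Nat.eq_zero_or_pos m with rfl | hm
    · simp
    · have : 0 ≤ Real.log (m : ℝ) := Real.log_nonneg (by exact_mod_cast hm)
      positivity
  exact le_min (by linarith [h3 (newformCount N)]) (by linarith [h3 (genusX0 N)])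

/-- **Prop. 10.8 (i) as a Faltings-height bound**: for `E/ℚ` of conductor `N` (globally minimal `W` with a
level-`N` datum), `2h(E) ≤ κ + α(N)` (`2h(E) − κ ≤ log m_f ≤ log r_f ≤ α` for the minimal curve `E_f` in
the isogeny class, `Pasten2024.exists_minimal_datum_in_class`).
[cite: VonkanelMatschke2023, Prop. 10.8 (i) (§10.5.2)] -/
theorem two_mul_height_le_alpha (hi : vonKanelMatschke_prop_10_8_i)
    (W : WeierstrassCurve ℚ) [W.IsElliptic] [W.IsGloballyMinimal]
    (N : ℕ) [NeZero N] (hN : W.conductorNorm ℤ = N) (D : ModularParametrizationData W N) :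
    2 * neronLatticeHeight D.L ≤ vkmKappa + vkmAlpha N := by
  obtain ⟨W', hW', D', hf, hmin⟩ := Pasten2024.exists_minimal_datum_in_class D
  obtain ⟨h1, h2, h3⟩ := hi W N hN D W' D' hf hmin
  linarith

/-- **"(eq:szpiro) with `α`"**: granted modularity and Prop. 10.8 (i), every elliptic curve `E/ℚ`
satisfies `log Δ_E ≤ 6 α(N_E) + 6κ + 16` (global minimal model, datum at level `N_E`,
`2h(E) ≤ κ + α(N_E)`, `log Δ_E ≤ 12 h(E) + 16`).
[cite: VonkanelMatschke2023, §10.5.1 (proof of Prop. 10.7) with §10.5.3 (derivation of (eq:szpiro))] -/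
theorem log_minimalDiscriminant_le_alpha (hmod : nonempty_modularParametrizationData)
    (hi : vonKanelMatschke_prop_10_8_i) (W : WeierstrassCurve ℚ) [W.IsElliptic] :
    Real.log (W.minimalDiscriminantNorm ℤ : ℝ) ≤
      6 * vkmAlpha (W.conductorNorm ℤ) + 6 * vkmKappa + 16 := by
  obtain ⟨C, hC⟩ := hasGlobalMinimalModel_rat_holds W
  haveI := hC
  have hNeq : (C • W).conductorNorm ℤ = W.conductorNorm ℤ := conductorNorm_smul_rat W C
  have hΔeq : (C • W).minimalDiscriminantNorm ℤ = W.minimalDiscriminantNorm ℤ :=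
    minimalDiscriminantNorm_smul_rat W C
  haveI : NeZero ((C • W).conductorNorm ℤ) := ⟨(conductorNorm_pos_holds (C • W)).ne'⟩
  obtain ⟨D⟩ := hmod (C • W)
  have h2h := two_mul_height_le_alpha hi (C • W) ((C • W).conductorNorm ℤ) rfl D
  have hS := pasten2024_log_minimalDiscriminant_le_holds (C • W) D.L D.isNeronLattice
  have hcast := Pasten2024.cast_minimalDiscriminantNorm_eq_abs (C • W)
  rw [← hNeq, ← hΔeq, hcast]
  linarith

end Literature.NumberTheory.EllipticCurves.ModularForms

namespace Literature.NumberTheory.DiophantineGeometry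

namespace VonKanelMatschke

open Literature.NumberTheory.EllipticCurves.ModularForms

/-! ### The `abc` half of Prop. 10.7 (as the proof of Prop. 10.6, with `α`) -/

/-- The case `H = |c|` (`|a|, |b| ≤ |c|`): `log|c| ≤ (6/5) α(2^𝔢 N_S) + 28`. As in the proof of Prop. 10.6:
`(|c|−1)⁵ ≤ |ab|c⁴ ≤ 2²⁸ Δ_{E'}`, `N_{E'} = N_E` with `ord₂(N_E) = 𝔢 + 1`, `N_E ∣ 2⁴ N_S`, whence
`N_E ∣ 2^𝔢 N_S` and `α(N_E) ≤ α(2^𝔢 N_S)`; `log Δ_{E'} ≤ 6α(N_E) + 6κ + 16`; `(33 log 2 + 115.1)/5 ≤ 28`.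
[cite: VonkanelMatschke2023, §10.5.1 (proof of Prop. 10.7) with §10.4 (proof of Prop. 10.6)] -/
private theorem abc_core_alpha (hmod : nonempty_modularParametrizationData)
    (hcond : ∀ (W W' : WeierstrassCurve ℚ) [W.IsElliptic] [W'.IsElliptic],
      W.IsIsogenous W' → W.conductorNorm ℤ = W'.conductorNorm ℤ)
    (h105 : vonKanelMatschke_lemma_10_5) (hi : vonKanelMatschke_prop_10_8_i)
    {S : Finset ℕ} (hS : ∀ p ∈ S, p.Prime) {a b c : ℤ} (ha : a ≠ 0) (hb : b ≠ 0) (hc : c ≠ 0)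
    (habc : a + b = c) (hg : Int.gcd (Int.gcd a b : ℤ) c = 1)
    (hrad : UniqueFactorizationMonoid.radical (a * b * c).natAbs ∣ primesProd S)
    (hac : |a| ≤ |c|) (hbc : |b| ≤ |c|) :
    Real.log |(c : ℝ)| ≤
      6 / 5 * vkmAlpha (refinedLevel (padicValNat 2 (a * b * c).natAbs) (primesProd S)) + 28 := by
  have hc2 : 2 ≤ |c| := by
    by_contra hlt
    have hc1 : |c| ≤ 1 := by rw [not_le] at hlt; omega
    obtain ⟨hc1a, hc1b⟩ := abs_le.mp hc1
    obtain ⟨ha1, ha2⟩ := abs_le.mp (hac.trans hc1)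
    obtain ⟨hb1, hb2⟩ := abs_le.mp (hbc.trans hc1)
    omega
  have hab : |c| - 1 ≤ |a| * |b| := by
    have h1 : |c| ≤ |a| + |b| := by rw [← habc]; exact abs_add_le a b
    nlinarith [Int.one_le_abs ha, Int.one_le_abs hb]
  obtain ⟨W, W', hW, hW', hiso, hNdvd, hv, -, m, hm3, hΔ'⟩ := h105 S hS a b c ha hb hc habc hg hrad
  haveI := hW
  haveI := hW'
  set N : ℕ := W.conductorNorm ℤ with hNdef
  have hN11 : 11 ≤ N := eleven_le_conductorNorm_of_modularity hmod W
  have hN0 : N ≠ 0 := by omega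
  haveI : NeZero N := ⟨hN0⟩
  have hN'eq : W'.conductorNorm ℤ = N := (hcond W W' hiso).symm
  have hΔ'pos : 0 < W'.minimalDiscriminantNorm ℤ := minimalDiscriminantNorm_pos_holds _
  have hszW : Real.log (W'.minimalDiscriminantNorm ℤ : ℝ) ≤ 6 * vkmAlpha N + 6 * vkmKappa + 16 := by
    have h := log_minimalDiscriminant_le_alpha hmod hi W'
    rwa [hN'eq] at h
  set P : ℕ := primesProd S with hPdef
  have hP1 : 1 ≤ P := one_le_primesProd hS
  have habc0 : (a * b * c).natAbs ≠ 0 := Int.natAbs_ne_zero.mpr (mul_ne_zero (mul_ne_zero ha hb) hc)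
  -- `N_S` is even
  have h2dvd : (2 : ℤ) ∣ a * b * c := by
    rcases Int.even_or_odd a with hA | hA
    · exact ((even_iff_two_dvd.mp hA).mul_right b).mul_right c
    · rcases Int.even_or_odd b with hB | hB
      · exact ((even_iff_two_dvd.mp hB).mul_left a).mul_right c
      · have hCe : Even c := by rw [← habc]; exact hA.add_odd hB
        exact (even_iff_two_dvd.mp hCe).mul_left (a * b)
  have h2P : 2 ∣ P := by
    have h2n : 2 ∣ (a * b * c).natAbs := Int.natAbs_dvd_natAbs.mpr h2dvd
    have h2r : 2 ∣ UniqueFactorizationMonoid.radical (a * b * c).natAbs := by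
      rw [Nat.radical_eq_prod_primeFactors]
      exact Finset.dvd_prod_of_mem (fun p : ℕ => p)
        (Nat.mem_primeFactors.mpr ⟨Nat.prime_two, h2n, habc0⟩)
    exact h2r.trans hrad
  obtain ⟨y₂, hy₂⟩ := h2P
  have hy₂0 : y₂ ≠ 0 := by rintro rfl; omega
  -- `N = 2^k N_odd`, `N_odd ∣ N_S / 2 = N_odd · t`
  set k : ℕ := padicValNat 2 N with hkdef
  obtain ⟨Nodd, hNodd⟩ : 2 ^ k ∣ N := pow_padicValNat_dvd
  have hNodd2 : ¬ 2 ∣ Nodd := by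
    rintro ⟨u, hu⟩
    have : 2 ^ (k + 1) ∣ N := ⟨u, by rw [hNodd, hu]; ring⟩
    exact pow_succ_padicValNat_not_dvd (p := 2) hN0 this
  have hNoddP : Nodd ∣ y₂ := by
    have h1 : Nodd ∣ 2 ^ 4 * P := (Dvd.intro_left _ hNodd.symm).trans hNdvd
    rw [hy₂, show 2 ^ 4 * (2 * y₂) = y₂ * 2 ^ 5 by ring] at h1
    have hcop : Nat.Coprime Nodd (2 ^ 5) :=
      Nat.Coprime.pow_right 5 ((Nat.Prime.coprime_iff_not_dvd Nat.prime_two).mpr hNodd2).symm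
    exact hcop.dvd_of_dvd_mul_right h1
  obtain ⟨t, ht⟩ := hNoddP
  have ht1 : 1 ≤ t := Nat.pos_of_ne_zero (by rintro rfl; rw [mul_zero] at ht; exact hy₂0 ht)
  -- `2^𝔢 N_S = N · t`
  set v : ℕ := padicValNat 2 (a * b * c).natAbs with hvdef
  have hY : refinedLevel v P = N * t := by
    unfold refinedLevel
    unfold refinedExp at hv
    split_ifs at hv ⊢
    · have hk : k = 5 := by omega
      rw [hy₂, ht, hNodd, hk]; ring
    · have hk : k = 3 := by omega
      rw [hy₂, ht, hNodd, hk]; ring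
    · have hk : k = 0 := by omega
      rw [hy₂, ht, hNodd, hk, Nat.mul_div_cancel_left _ (by norm_num : 0 < 2)]; ring
    · have hk : k = 1 := by omega
      rw [hy₂, ht, hNodd, hk]; ring
  have hY0 : refinedLevel v P ≠ 0 := by rw [hY]; exact Nat.mul_ne_zero hN0 (by omega)
  haveI : NeZero (refinedLevel v P) := ⟨hY0⟩
  have hα : vkmAlpha N ≤ vkmAlpha (refinedLevel v P) := vkmAlpha_le_of_dvd ⟨t, hY⟩
  -- `(|c| − 1)⁵ ≤ 2²⁸ Δ_{E'}`
  have hD0 : (0 : ℝ) < (W'.minimalDiscriminantNorm ℤ : ℝ) := by exact_mod_cast hΔ'pos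
  have hc2r : (2 : ℝ) ≤ |(c : ℝ)| := by exact_mod_cast hc2
  have habr : |(c : ℝ)| - 1 ≤ |(a : ℝ)| * |(b : ℝ)| := by exact_mod_cast hab
  have hΔr : (2 : ℝ) ^ (12 * m) * (W'.minimalDiscriminantNorm ℤ : ℝ) =
      2 ^ 8 * (|(a : ℝ)| * |(b : ℝ)|) * |(c : ℝ)| ^ 4 := by
    have h' : ((2 ^ (12 * m) * W'.minimalDiscriminantNorm ℤ : ℕ) : ℝ) =
        ((2 ^ 8 * (a * b).natAbs * c.natAbs ^ 4 : ℕ) : ℝ) := by exact_mod_cast hΔ'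
    push_cast [Int.natAbs_mul, Nat.cast_natAbs, Int.cast_abs] at h'
    linarith
  have hm : (2 : ℝ) ^ (12 * m) ≤ 2 ^ 36 := pow_le_pow_right₀ (by norm_num) (by omega)
  have hCD : (|(c : ℝ)| - 1) ^ 5 ≤ 2 ^ 28 * (W'.minimalDiscriminantNorm ℤ : ℝ) := by
    have h0 : 0 ≤ |(c : ℝ)| - 1 := by linarith
    have h1 : (|(c : ℝ)| - 1) ^ 4 ≤ |(c : ℝ)| ^ 4 := pow_le_pow_left₀ h0 (by linarith) 4
    have h2 : (|(c : ℝ)| - 1) ^ 5 ≤ (|(a : ℝ)| * |(b : ℝ)|) * |(c : ℝ)| ^ 4 := by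
      rw [pow_succ']
      exact mul_le_mul habr h1 (by positivity) (by positivity)
    have h3 : (|(a : ℝ)| * |(b : ℝ)|) * |(c : ℝ)| ^ 4 ≤ 2 ^ 28 * (W'.minimalDiscriminantNorm ℤ : ℝ) := by
      nlinarith
    linarith
  -- the tail
  have hl2 := Real.log_two_lt_d9
  have hκ := six_mul_vkmKappa_add_sixteen_le
  have hC1 : 0 < |(c : ℝ)| - 1 := by linarith
  have h3 : 5 * Real.log (|(c : ℝ)| - 1) ≤ 28 * Real.log 2 + Real.log (W'.minimalDiscriminantNorm ℤ : ℝ) := by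
    have := Real.log_le_log (by positivity) hCD
    rw [Real.log_pow, Real.log_mul (by norm_num) hD0.ne', Real.log_pow] at this
    push_cast at this; linarith
  have h4 : Real.log |(c : ℝ)| ≤ Real.log 2 + Real.log (|(c : ℝ)| - 1) := by
    rw [← Real.log_mul (by norm_num) hC1.ne']
    exact Real.log_le_log (by linarith) (by linarith)
  linarith

/-- **The `abc` half of Prop. 10.7 ⟸ Lemma 10.5 + Prop. 10.8 (i)** (granted modularity and the isogeny
invariance of the conductor `hcond`): every solution of (eq:abc) has `log max(|a|,|b|,|c|) ≤ (6/5) α(2^𝔢 N_S) + 28`;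
the cases `H = |a|`, `|b|` by the solutions `(b, −c, −a)`, `(a, −c, −b)` as in the proof of Prop. 10.6.
[cite: VonkanelMatschke2023, Prop. 10.7 (§10.5.1), first statement, and its proof] -/
theorem abc_log_max_le_alpha_of_lemma_10_5_of_conductorNorm_eq (hmod : nonempty_modularParametrizationData)
    (hcond : ∀ (W W' : WeierstrassCurve ℚ) [W.IsElliptic] [W'.IsElliptic],
      W.IsIsogenous W' → W.conductorNorm ℤ = W'.conductorNorm ℤ)
    (h105 : vonKanelMatschke_lemma_10_5) (hi : vonKanelMatschke_prop_10_8_i)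
    (S : Finset ℕ) (hS : ∀ p ∈ S, p.Prime) (a b c : ℤ) (ha : a ≠ 0) (hb : b ≠ 0) (hc : c ≠ 0)
    (habc : a + b = c) (hg : Int.gcd (Int.gcd a b : ℤ) c = 1)
    (hrad : UniqueFactorizationMonoid.radical (a * b * c).natAbs ∣ primesProd S) :
    Real.log ((max |a| (max |b| |c|) : ℤ) : ℝ) ≤
      6 / 5 * vkmAlpha (refinedLevel (padicValNat 2 (a * b * c).natAbs) (primesProd S)) + 28 := by
  have hg' : ∀ x y z : ℤ, Int.gcd (Int.gcd x y : ℤ) z = 1 → Int.gcd (Int.gcd y (-z) : ℤ) (-x) = 1 := by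
    intro x y z h; simp only [Int.gcd, Int.natAbs_neg, Int.natAbs_natCast] at h ⊢
    rwa [Nat.gcd_comm, ← Nat.gcd_assoc]
  have hg'' : ∀ x y z : ℤ, Int.gcd (Int.gcd x y : ℤ) z = 1 → Int.gcd (Int.gcd x (-z) : ℤ) (-y) = 1 := by
    intro x y z h; simp only [Int.gcd, Int.natAbs_neg, Int.natAbs_natCast] at h ⊢
    rwa [Nat.gcd_assoc, Nat.gcd_comm z.natAbs, ← Nat.gcd_assoc]
  push_cast
  have cast_le : ∀ {x y : ℤ}, |x| ≤ |y| → |(x : ℝ)| ≤ |(y : ℝ)| := fun h => by exact_mod_cast h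
  have eB : a * -c * -b = a * b * c := by ring
  have eA : b * -c * -a = a * b * c := by ring
  rcases le_total |a| |c| with hac | hca
  · rcases le_total |b| |c| with hbc | hcb
    · rw [max_eq_right (cast_le hbc), max_eq_right (cast_le hac)]
      exact abc_core_alpha hmod hcond h105 hi hS ha hb hc habc hg hrad hac hbc
    · rw [max_eq_left (cast_le hcb), max_eq_right (cast_le (hac.trans hcb))]
      have key := abc_core_alpha hmod hcond h105 hi hS ha (neg_ne_zero.mpr hc) (neg_ne_zero.mpr hb)
        (by linarith) (hg'' a b c hg) (by rw [eB]; exact hrad) (by rw [abs_neg]; exact hac.trans hcb)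
        (by rw [abs_neg, abs_neg]; exact hcb)
      rw [eB] at key; push_cast [abs_neg] at key; exact key
  · rcases le_total |b| |a| with hba | hab
    · rw [max_eq_left (max_le (cast_le hba) (cast_le hca))]
      have key := abc_core_alpha hmod hcond h105 hi hS hb (neg_ne_zero.mpr hc) (neg_ne_zero.mpr ha)
        (by linarith) (hg' a b c hg) (by rw [eA]; exact hrad) (by rw [abs_neg]; exact hba)
        (by rw [abs_neg, abs_neg]; exact hca)
      rw [eA] at key; push_cast [abs_neg] at key; exact key
    · rw [max_eq_left (cast_le (hca.trans hab)), max_eq_right (cast_le hab)]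
      have key := abc_core_alpha hmod hcond h105 hi hS ha (neg_ne_zero.mpr hc) (neg_ne_zero.mpr hb)
        (by linarith) (hg'' a b c hg) (by rw [eB]; exact hrad) (by rw [abs_neg]; exact hab)
        (by rw [abs_neg, abs_neg]; exact hca.trans hab)
      rw [eB] at key; push_cast [abs_neg] at key; exact key

/-- **The `abc` half of Prop. 10.7 ⟸ Lemma 10.5 + Prop. 10.8 (i)**, the conductor invariance supplied by the
Ogg–Saito schema (`conductorNorm_eq_of_isIsogenous_of_tate`).
[cite: VonkanelMatschke2023, Prop. 10.7 (§10.5.1), first statement, and its proof] -/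
theorem abc_log_max_le_alpha_of_lemma_10_5 (hmod : nonempty_modularParametrizationData)
    (hOS : ∀ (W : WeierstrassCurve ℚ) (ℓ : ℕ) [Fact ℓ.Prime],
      W.artinConductorExponent_tate_eq_conductorExponent_of_isElliptic ℓ)
    (h105 : vonKanelMatschke_lemma_10_5) (hi : vonKanelMatschke_prop_10_8_i)
    (S : Finset ℕ) (hS : ∀ p ∈ S, p.Prime) (a b c : ℤ) (ha : a ≠ 0) (hb : b ≠ 0) (hc : c ≠ 0)
    (habc : a + b = c) (hg : Int.gcd (Int.gcd a b : ℤ) c = 1)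
    (hrad : UniqueFactorizationMonoid.radical (a * b * c).natAbs ∣ primesProd S) :
    Real.log ((max |a| (max |b| |c|) : ℤ) : ℝ) ≤
      6 / 5 * vkmAlpha (refinedLevel (padicValNat 2 (a * b * c).natAbs) (primesProd S)) + 28 :=
  abc_log_max_le_alpha_of_lemma_10_5_of_conductorNorm_eq hmod (conductorNorm_eq_of_isIsogenous_of_tate hOS)
    h105 hi S hS a b c ha hb hc habc hg hrad

/-! ### The Mordell half of Prop. 10.7 (as the proof of Prop. 10.1, with `α`) -/

/-- **The Mordell half of Prop. 10.7 ⟸ Lemma 10.3 + Prop. 10.8 (i)** (granted modularity): every solution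
`(x, y) ∈ 𝒪 × 𝒪` of `y² = x³ + a` has `max(h(x), (2/3)h(y)) ≤ Ω_opt(a, S) = (1/3)h(a) + 4α(a_S) +
2 log(α(a_S) + κ) + 35 + 4κ`: Lemma 10.3 gives `≤ (1/3)h(a) + 8h(E) + 2 log max(1, h(E)) + 36` with
`N_E ∣ a_S`, and `2h(E) ≤ κ + α(N_E) ≤ κ + α(a_S)`, `max(1, h(E)) ≤ (α(a_S) + κ)/2`, `36 − 2 log 2 ≤ 35`.
[cite: VonkanelMatschke2023, Prop. 10.7 (§10.5.1), second statement, with §10.3 (proof of Prop. 10.1)] -/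
theorem mordell_height_le_omegaOpt_of_lemma_10_3 (hmod : nonempty_modularParametrizationData)
    (h103 : vonKanelMatschke_lemma_10_3) (hi : vonKanelMatschke_prop_10_8_i)
    (S : Finset ℕ) (hS : ∀ p ∈ S, p.Prime) (a : ℚ) (ha : a ≠ 0) (haS : IsSInteger S a)
    (x y : ℚ) (hx : IsSInteger S x) (hy : IsSInteger S y) (hxy : y ^ 2 = x ^ 3 + a) :
    max (logHeight₁ x) (2 / 3 * logHeight₁ y) ≤ omegaOpt S a := by
  obtain ⟨W, hW, hWmin, u, -, -, -, hNdvd, hbound⟩ := h103 S hS a ha haS x y hx hy hxy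
  haveI := hW
  haveI := hWmin
  haveI : NeZero (W.conductorNorm ℤ) := ⟨(conductorNorm_pos_holds W).ne'⟩
  obtain ⟨D⟩ := hmod W
  have h2h := two_mul_height_le_alpha hi W (W.conductorNorm ℤ) rfl D
  have hL := hbound D.L D.isNeronLattice
  have hM := le_mordellLevel hS a
  haveI : NeZero (mordellLevel S a) := ⟨by omega⟩
  have hmono : vkmAlpha (W.conductorNorm ℤ) ≤ vkmAlpha (mordellLevel S a) := vkmAlpha_le_of_dvd hNdvd
  have hα0 := zero_le_vkmAlpha (W.conductorNorm ℤ)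
  have hκ12 : 12 ≤ vkmKappa := by
    unfold vkmKappa
    have hπ := Real.pi_gt_three
    have hπ4 := Real.pi_lt_four
    have hlog : 0 ≤ Real.log (163 / Real.pi) :=
      Real.log_nonneg (by rw [le_div_iff₀ Real.pi_pos]; linarith)
    linarith
  unfold omegaOpt
  set α := vkmAlpha (mordellLevel S a) with hαdef
  set h := neronLatticeHeight D.L with hhdef
  have hmax : max 1 h ≤ (α + vkmKappa) / 2 := max_le (by linarith) (by linarith)
  have hlogmax : Real.log (max 1 h) ≤ Real.log (α + vkmKappa) - Real.log 2 := by
    have := Real.log_le_log (lt_of_lt_of_le one_pos (le_max_left 1 h)) hmax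
    rwa [Real.log_div (by linarith) (by norm_num)] at this
  have hl2 := Real.log_two_gt_d9
  linarith

/-! ### Prop. 10.7 from the roots -/

/-- **vKM Prop. 10.7 ⟸ {modularity, conductor isogeny-invariance, Lemma 10.3, Lemma 10.5, Prop. 10.8 (i)}**
(PROVED assembly of the printed proof of §10.5.1): the named fact `proposition_10_7` (both optimized
bounds, `(6/5) α(2^𝔢 N_S) + 28` for (eq:abc) and `Ω_opt` for Mordell) follows from the constructions
(Lemmas 10.3, 10.5), the inequality chain of Prop. 10.8 (i), modularity (a parametrisation datum at level
`N_E`), and the isogeny invariance of the conductor `hcond`, using `α(m) ≤ α(n)` for `m ∣ n`.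
[cite: VonkanelMatschke2023, Prop. 10.7 (§10.5.1, prop:algobounds) and its proof] -/
theorem proposition_10_7_of_conductorNorm_eq (hmod : nonempty_modularParametrizationData)
    (hcond : ∀ (W W' : WeierstrassCurve ℚ) [W.IsElliptic] [W'.IsElliptic],
      W.IsIsogenous W' → W.conductorNorm ℤ = W'.conductorNorm ℤ)
    (h105 : vonKanelMatschke_lemma_10_5) (h103 : vonKanelMatschke_lemma_10_3)
    (hi : vonKanelMatschke_prop_10_8_i) : proposition_10_7 :=
  ⟨fun S hS a b c ha hb hc habc hg hrad ↦
      abc_log_max_le_alpha_of_lemma_10_5_of_conductorNorm_eq hmod hcond h105 hi S hS a b c ha hb hc habc hg hrad,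
    fun S hS a ha haS x y hx hy hxy ↦
      mordell_height_le_omegaOpt_of_lemma_10_3 hmod h103 hi S hS a ha haS x y hx hy hxy⟩

/-- **vKM Prop. 10.7 ⟸ {modularity, Ogg–Saito schema, Lemma 10.3, Lemma 10.5, Prop. 10.8 (i)}**, the conductor
invariance supplied by the Ogg–Saito schema (`conductorNorm_eq_of_isIsogenous_of_tate`).
[cite: VonkanelMatschke2023, Prop. 10.7 (§10.5.1, prop:algobounds) and its proof] -/
theorem proposition_10_7_of_roots (hmod : nonempty_modularParametrizationData)
    (hOS : ∀ (W : WeierstrassCurve ℚ) (ℓ : ℕ) [Fact ℓ.Prime],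
      W.artinConductorExponent_tate_eq_conductorExponent_of_isElliptic ℓ)
    (h105 : vonKanelMatschke_lemma_10_5) (h103 : vonKanelMatschke_lemma_10_3)
    (hi : vonKanelMatschke_prop_10_8_i) : proposition_10_7 :=
  proposition_10_7_of_conductorNorm_eq hmod (conductorNorm_eq_of_isIsogenous_of_tate hOS) h105 h103 hi

/-- **Prop. 10.1 (`mordell_height_le`, the bound `Ω_sim`) ⟸ {modularity, Lemma 10.3, Prop. 10.8 (i)} via
Prop. 10.7 and `Ω_opt ≤ Ω_sim`** — the second printed road (`mordell_height_le_of_proposition_10_7`), now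
with both of its inputs derived. [cite: VonkanelMatschke2023, §10.1 and Prop. 10.7] -/
theorem mordell_height_le_of_lemma_10_3_via_proposition_10_7 (hmod : nonempty_modularParametrizationData)
    (h103 : vonKanelMatschke_lemma_10_3) (hi : vonKanelMatschke_prop_10_8_i)
    (hle : omegaOpt_le_omegaSim) : mordell_height_le := by
  intro S hS a ha haS x y hx hy hxy
  exact (mordell_height_le_omegaOpt_of_lemma_10_3 hmod h103 hi S hS a ha haS x y hx hy hxy).trans
    (hle S hS a ha haS)

end VonKanelMatschke

end Literature.NumberTheory.DiophantineGeometry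

end
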